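import Mathlib
import HarnessLib
import Summits.QuantumFields.YangMills.Theses.SwapTwistDeficit
import Summits.QuantumFields.YangMills.Theses.SlowBitWindow
import Summits.QuantumFields.YangMills.Theorems.LuscherReductionRunningReductionTraceFormula
import Summits.QuantumFields.YangMills.Theorems.FemtoTransferGapBounds
import Summits.QuantumFields.YangMills.Theorems.FemtoTransferGapPositivity

/-!
# SwapTwistDeficit — the Assembly item, and the bridge from SlowBitWindow

* `assembly_holds : Theses.SwapTwistDeficit.Assembly` — `TwistDoor → TwistDeficit → SubFemtoEntropy → ThermalTraceWindow.SubFemtoFirstLevel`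
  (pure algebra: `β^(-k) Z(2L) ≤ Z(2L) − Z^S(2L) ≤ 2 λ₁^L Z(L) ≤ 2 λ₁^L β^q λ₀^L` and `λ₀^(2L) ≤ Z(2L)`).
* `twistDeficit_of_slowBit : SlowBitWindow.JensenDoor → SlowBitWindow.StepPersistence → CauchySchwarzDoor → TwistDeficit` —
  the crux pair of line g10-A implies the crux of line g10-B (exponent `2k+1`): antipodal persistence `β^(-k) Z(2L) ≤ insTrace(O, L)` from
  Jensen, then `insTrace(O, L)² ≤ 2 Z(2L) (Z(2L) − Z^S(2L))`.
D-0145 lines g10-A/B of seat ym-idea-4; no summit is proved here.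
-/

open MeasureTheory
open Literature.MathematicalPhysics.QuantumFieldTheory
open Literature.MathematicalPhysics.QuantumLattice
open scoped BigOperators

namespace Summit.QuantumFields.YangMills.Theses.SwapTwistDeficit

open Summit.QuantumFields.YangMills.Theorems.FemtoTransferGap
open Summit.QuantumFields.YangMills.Theorems.FemtoTransferGap.TT

/-- The Assembly item of route SwapTwistDeficit: `TwistDoor → TwistDeficit → SubFemtoEntropy → ThermalTraceWindow.SubFemtoFirstLevel`
(pure algebra; K2a exponent `k + q + 1`, threshold `max β₀ β₀' 2`). [cite: Luscher1983, §2] -/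
theorem assembly_holds : Assembly := by
  intro hD hP hE A hA
  obtain ⟨k, β₁, L₁, hP'⟩ := hP A hA
  obtain ⟨q, β₂, L₂, hE'⟩ := hE A hA
  refine ⟨k + q + 1, max (max β₁ β₂) 2, max (max L₁ L₂) 2, ?_⟩
  intro β hβ L _ hL hLA
  simp only [max_le_iff] at hβ hL
  obtain ⟨⟨hβ₁, hβ₂⟩, hβ2⟩ := hβ
  obtain ⟨⟨hL₁, hL₂⟩, hL2⟩ := hL
  have hβpos : 0 < β := by linarith
  have hβ1 : (1 : ℝ) ≤ β := by linarith
  have hdef : β ^ (-k) * physTrace L β (2 * L) ≤ physTrace L β (2 * L) - twistTrace L β (2 * L) := hP' β hβ₁ L hL₁ hLA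
  have hent : physTrace L β L ≤ β ^ q * levelValue su2Rep L β 0 ^ L := hE' β hβ₂ L hL₂ hLA
  have hdoor : physTrace L β (2 * L) - twistTrace L β (2 * L) ≤ 2 * levelValue su2Rep L β 1 ^ L * physTrace L β L :=
    hD L hL2 β hβ1
  have hlam0 : 0 < levelValue su2Rep L β 0 := levelValue_zero_su2Rep_pos L β
  have hlamnn : ∀ j, 0 ≤ levelValue su2Rep L β j := fun j =>
    levelValue_nonneg_of_qform_nonneg su2Rep β (fun ψ hψ => qform_su2Rep_self_nonneg hβpos.le hψ) j
  have hTF := TT.traceFormula_all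
  have hZ2 : levelValue su2Rep L β 0 ^ (2 * L) ≤ physTrace L β (2 * L) :=
    le_hasSum (hTF L β (2 * L) hβ1 (by omega)) 0 (fun j _ => pow_nonneg (hlamnn j) _)
  set Z₁ := physTrace L β L with hZ₁def
  set Z₂ := physTrace L β (2 * L) with hZ₂def
  set l0 := levelValue su2Rep L β 0 with hl0def
  set l1 := levelValue su2Rep L β 1 with hl1def
  have h4 : β ^ (-k) * Z₂ ≤ 2 * l1 ^ L * Z₁ := hdef.trans hdoor
  have hβk : 0 < β ^ (-k) := Real.rpow_pos_of_pos hβpos _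
  have h5 : β ^ (-k) * l0 ^ (2 * L) ≤ 2 * l1 ^ L * (β ^ q * l0 ^ L) := by
    calc β ^ (-k) * l0 ^ (2 * L) ≤ β ^ (-k) * Z₂ := mul_le_mul_of_nonneg_left hZ2 hβk.le
      _ ≤ 2 * l1 ^ L * Z₁ := h4
      _ ≤ 2 * l1 ^ L * (β ^ q * l0 ^ L) :=
          mul_le_mul_of_nonneg_left hent (mul_nonneg (by norm_num) (pow_nonneg (hlamnn 1) _))
  have hl0L : 0 < l0 ^ L := pow_pos hlam0 _
  have h6 : β ^ (-k) * l0 ^ L ≤ 2 * β ^ q * l1 ^ L := by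
    have h' : (β ^ (-k) * l0 ^ L) * l0 ^ L ≤ (2 * β ^ q * l1 ^ L) * l0 ^ L := by
      have e1 : β ^ (-k) * l0 ^ (2 * L) = (β ^ (-k) * l0 ^ L) * l0 ^ L := by rw [two_mul, pow_add]; ring
      have e2 : 2 * l1 ^ L * (β ^ q * l0 ^ L) = (2 * β ^ q * l1 ^ L) * l0 ^ L := by ring
      rw [← e1, ← e2]; exact h5
    exact le_of_mul_le_mul_right h' hl0L
  have hβq : 0 < β ^ q := Real.rpow_pos_of_pos hβpos _
  have hsplit : β ^ (-(k + q + 1)) = β ^ (-k) * (β ^ q)⁻¹ * β⁻¹ := by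
    rw [show -(k + q + 1) = -k + -q + -1 by ring, Real.rpow_add hβpos, Real.rpow_add hβpos, Real.rpow_neg hβpos.le q,
      Real.rpow_neg_one]
  rw [hsplit]
  have hβinv : β⁻¹ ≤ 1 / 2 := by rw [inv_eq_one_div]; exact one_div_le_one_div_of_le (by norm_num) hβ2
  have h7 : β ^ (-k) * (β ^ q)⁻¹ * l0 ^ L ≤ 2 * l1 ^ L := by
    have := div_le_div_of_nonneg_right h6 hβq.le
    have e1 : β ^ (-k) * l0 ^ L / β ^ q = β ^ (-k) * (β ^ q)⁻¹ * l0 ^ L := by ring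
    have e2 : 2 * β ^ q * l1 ^ L / β ^ q = 2 * l1 ^ L := by field_simp
    rw [e1, e2] at this; exact this
  have hnn : 0 ≤ β ^ (-k) * (β ^ q)⁻¹ * l0 ^ L := by positivity
  calc β ^ (-k) * (β ^ q)⁻¹ * β⁻¹ * l0 ^ L = β⁻¹ * (β ^ (-k) * (β ^ q)⁻¹ * l0 ^ L) := by ring
    _ ≤ (1 / 2) * (β ^ (-k) * (β ^ q)⁻¹ * l0 ^ L) := mul_le_mul_of_nonneg_right hβinv hnn
    _ ≤ (1 / 2) * (2 * l1 ^ L) := mul_le_mul_of_nonneg_left h7 (by norm_num)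
    _ = l1 ^ L := by ring

/-- SlowBitWindow's crux pair feeds this line: StepPersistence ∧ JensenDoor give antipodal persistence, and the
Cauchy–Schwarz door turns antipodal persistence into the twist deficit (with exponent 2k+1). -/
theorem twistDeficit_of_slowBit (hJ : Summit.QuantumFields.YangMills.Theses.SlowBitWindow.JensenDoor)
    (hP : Summit.QuantumFields.YangMills.Theses.SlowBitWindow.StepPersistence) (hCS : CauchySchwarzDoor) : TwistDeficit := by
  intro A hA
  obtain ⟨k, β₁, L₁, hP'⟩ := hP A hA
  refine ⟨2 * k + 1, max β₁ 2, max L₁ 2, ?_⟩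
  intro β hβ L _ hL hLA
  simp only [max_le_iff] at hβ hL
  obtain ⟨hβ₁, hβ2⟩ := hβ
  obtain ⟨hL₁, hL2⟩ := hL
  have hβpos : 0 < β := by linarith
  have hβ1 : (1 : ℝ) ≤ β := by linarith
  have hLne : L ≠ 0 := by omega
  obtain ⟨O, hO, hO1, hOodd, hstep⟩ := hP' β hβ₁ L hL₁ hLA
  have hjen := hJ L hL2 β hβ1 O hO hO1
  have hcs := hCS L hL2 β hβ1 O hO hO1 hOodd
  -- positivity of Z₂
  have hlam0 : 0 < levelValue su2Rep L β 0 := levelValue_zero_su2Rep_pos L β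
  have hlamnn : ∀ j, 0 ≤ levelValue su2Rep L β j := fun j =>
    levelValue_nonneg_of_qform_nonneg su2Rep β (fun ψ hψ => qform_su2Rep_self_nonneg hβpos.le hψ) j
  have hZ2 : levelValue su2Rep L β 0 ^ (2 * L) ≤ physTrace L β (2 * L) :=
    le_hasSum (TT.traceFormula_all L β (2 * L) hβ1 (by omega)) 0 (fun j _ => pow_nonneg (hlamnn j) _)
  have hZ2pos : 0 < physTrace L β (2 * L) := lt_of_lt_of_le (pow_pos hlam0 _) hZ2
  set Z₂ := physTrace L β (2 * L) with hZ₂def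
  set D := physTrace L β (2 * L) - twistTrace L β (2 * L) with hDdef
  set I₁ := insTrace L β O 1
  set IL := insTrace L β O L
  -- antipodal persistence: β^{-k} Z₂ ≤ IL
  have hδpos : 0 < β ^ (-k / (L : ℝ)) := Real.rpow_pos_of_pos hβpos _
  have h1 : (β ^ (-k / (L : ℝ)) * Z₂) ^ L ≤ I₁ ^ L := pow_le_pow_left₀ (by positivity) hstep L
  have hpowβ : (β ^ (-k / (L : ℝ))) ^ L = β ^ (-k) := by
    rw [← Real.rpow_natCast, ← Real.rpow_mul hβpos.le]; congr 1; field_simp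
  have h2 : β ^ (-k) * (Z₂ * Z₂ ^ (L - 1)) ≤ IL * Z₂ ^ (L - 1) := by
    have e : (β ^ (-k / (L : ℝ)) * Z₂) ^ L = β ^ (-k) * (Z₂ * Z₂ ^ (L - 1)) := by
      rw [mul_pow, hpowβ]; congr 1
      conv_lhs => rw [show L = (L - 1) + 1 by omega]
      rw [pow_succ, mul_comm]
    rw [← e]; exact h1.trans hjen
  have hZ2pow' : 0 < Z₂ ^ (L - 1) := pow_pos hZ2pos _
  have hant : β ^ (-k) * Z₂ ≤ IL := by
    have h' : (β ^ (-k) * Z₂) * Z₂ ^ (L - 1) ≤ IL * Z₂ ^ (L - 1) := by simpa [mul_assoc] using h2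
    exact le_of_mul_le_mul_right h' hZ2pow'
  -- Cauchy–Schwarz door: IL² ≤ 2 Z₂ D, hence β^{-2k} Z₂² ≤ 2 Z₂ D, i.e. β^{-2k} Z₂ ≤ 2 D
  have hβk : 0 < β ^ (-k) := Real.rpow_pos_of_pos hβpos _
  have h3 : (β ^ (-k) * Z₂) ^ 2 ≤ 2 * Z₂ * D := (pow_le_pow_left₀ (by positivity) hant 2).trans hcs
  have h4 : β ^ (-(2 * k)) * Z₂ ≤ 2 * D := by
    have e : (β ^ (-k) * Z₂) ^ 2 = (β ^ (-(2 * k)) * Z₂) * Z₂ := by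
      rw [mul_pow, sq, ← Real.rpow_add hβpos, show -k + -k = -(2 * k) by ring]; ring
    rw [e] at h3
    have h' : (β ^ (-(2 * k)) * Z₂) * Z₂ ≤ (2 * D) * Z₂ := by linarith [h3]
    exact le_of_mul_le_mul_right h' hZ2pos
  -- β^{-(2k+1)} Z₂ = β⁻¹ β^{-2k} Z₂ ≤ ½ · 2 D = D
  have hsplit : β ^ (-(2 * k + 1)) = β ^ (-(2 * k)) * β⁻¹ := by
    rw [show -(2 * k + 1) = -(2 * k) + -1 by ring, Real.rpow_add hβpos, Real.rpow_neg_one]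
  rw [hsplit]
  have hβinv : β⁻¹ ≤ 1 / 2 := by rw [inv_eq_one_div]; exact one_div_le_one_div_of_le (by norm_num) hβ2
  have hnn : 0 ≤ β ^ (-(2 * k)) * Z₂ := by positivity
  calc β ^ (-(2 * k)) * β⁻¹ * Z₂ = β⁻¹ * (β ^ (-(2 * k)) * Z₂) := by ring
    _ ≤ (1 / 2) * (β ^ (-(2 * k)) * Z₂) := mul_le_mul_of_nonneg_right hβinv hnn
    _ ≤ (1 / 2) * (2 * D) := mul_le_mul_of_nonneg_left h4 (by norm_num)
    _ = D := by ring

end Summit.QuantumFields.YangMills.Theses.SwapTwistDeficit
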